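/-
Copyright (c) 2026 the pub-hodgecm-mathlib formalisation cell (harness21).  Prover seat hodgecm-mathlib-K2Liu-p01 (g0): Track B «K2-LIT»,
#184♮ = hLiu418 = stmt-HodgeConjecture-24832, LEAD F0P6-plan (g10) «SKELETON LANDED K2Liu №2» (K2/STATUS 20:51:12Z) and DEAL BY NAME
(20:51:45Z), file #10b of the K2_Liu road (planner K2Liu-plan (g0), socket module
`Cruxes/HLiu418/Lines/K2_Liu_CurveThetaSigs_U3a_SiegelEisenstein.lean` feca6d8e9697719e); 2026-09-03.
-/
import Literature.NumberTheory.K2Lit.SiegelEisensteinSeriesDoubled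
import Summits.HodgeConjecture.HodgeConjecture.Theorems.K2LiuSiegelCharacterTrivialOnRational
import HarnessLib

/-!
# Crux `HLiu418`, Track B road `K2_Liu` (Liu 2021, Thm. B.4 (1)), unit U3a «SIEGEL EISENSTEIN SERIES», file #10b:
# left `H(L⁺)`-invariance of the Siegel–hermitian Eisenstein series of the doubled group

Cell `hodgecm-mathlib`, crux item hLiu418 = `stmt-HodgeConjecture-24832`, route of record `HCCMUnconditional`; squad K2 ∕ K2Liu,
LEAD F0P6-plan (g10), planner K2Liu-plan (g0), prover K2Liu-p01 (g0).  THEOREMS ONLY (no `def`, no instance, no notation, no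
named-fact hypothesis, no `sorry`, default heartbeats); imports = ★ K2Lit leaf D2-bis `SiegelEisensteinSeriesDoubled` (p854694:
`eisensteinSeriesDelta`, `SiegelDeltaQuot`, `siegelDeltaRat`, `IsSiegelDeltaSection`, `siegelDeltaCharacter`) + ★ file #10a
`Theorems/K2LiuSiegelCharacterTrivialOnRational` (p854746, K2Liu-p02 (g0): ★ `siegelDeltaCharacter_eq_one_of_mem_ratH` — the inducing
character is `1` on ALL of `H(L⁺)`, via ★ `detDelta_unit_mem_principalIdeles`, `χ|_{L^×} = 1` and the product formula) + HarnessLib;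
lane `--supports stmt-HodgeConjecture-24832 --as helper` (count-neutral).

WHAT IS PROVED.  `siegelEisensteinDoubledLeftInvariant` — statement bytes = the socket
`…Cruxes.HLiu418.K2LiuCurveThetaSigsU3aSiegelEisenstein.sig_K2LiuSiegelEisensteinDoubledLeftInvariant` VERBATIM: for the CM datum of
record (`L` CM, `𝕍 = V ⊗ W` with diagonal Gram data `dV`, `dW`), a Hecke character `χ` of `L`, `s ∈ ℂ`, a Siegel section `f` of
`I(s, χ)` on the doubled group `H(𝔸) = U(𝕍 ⊕ −𝕍)(𝔸)` (★ `IsSiegelDeltaSection χ s f`: `f(p h) = χ(det_Δ p)|det_Δ p|^{s+n/2} f(h)` on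
`P_Δ(𝔸)`), every rational `γ ∈ H(L⁺)` and every `h ∈ H(𝔸)`:
`E(γ h; f) = E(h; f)`, where `E(h; f) = ∑'_{q ∈ P_Δ(L⁺)\H(L⁺)} f(q.out · h)` (★ `eisensteinSeriesDelta`).

PROOF (pure algebra — NO convergence is used; Liu 2021 §B.3 p. 101, Tan 1999 §1: `E_{P_a}(·; f)` is a function on
`U(V^◇)(F)\U(V^◇)(𝔸_F)`).  (1) Right multiplication by `γ` commutes with the LEFT action of `P_Δ(L⁺)` on `H(L⁺)`, so it induces a
permutation `σ` of the coset space `P_Δ(L⁺)\H(L⁺)` with `σ⟦a⟧ = ⟦a γ⟧` (Mathlib `Quotient.congr (Equiv.mulRight γ)`); `tsum` is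
invariant under re-indexing by ANY `Equiv`, whatever the summability (Mathlib `Equiv.tsum_eq`) — so
`E(h; f) = ∑'_q f((σ q).out · h)`.  (2) Termwise, `(σ q).out = p · (q.out · γ)` for some `p ∈ P_Δ(L⁺)` (both represent `σ q`), and
`f(p · x) = χ(det_Δ p)|det_Δ p|^{s+n/2} · f(x) = f(x)`: the inducing character is `1` on RATIONAL elements — the content of
socket #10a, IMPORTED BY NAME from K2Liu-p02's ★ file (★ `K2LiuSiegelCharacterTrivialOnRational.siegelDeltaCharacter_eq_one_of_mem_ratH`:
if `det_Δ p` is a unit it is a principal idele, ★ `detDelta_unit_mem_principalIdeles`, on which `χ = 1` (★ `HeckeCharacter.map_principal`)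
and `|·|_{𝔸_L} = 1` (product formula, ★ `ideleNorm_eq_one_of_mem_principalIdeles`); off units both factors are `1` by definition).
Hence `f(q.out · γ · h) = f((σ q).out · h)` and the two series agree term by term.

HONEST LABEL.  Count-neutral scaffold file of the K2_Liu road (doubling method, `a = 0`); it retires nothing by itself: `HC_CM` is
proved only modulo the 7 printed citations (2 remaining named inputs: hLiu418 = `stmt-HodgeConjecture-24832`, h413 =
`stmt-HodgeConjecture-24833`) until rung 0 closes.

## References
* [Liu2021] Y. Liu, *Fourier–Jacobi cycles and arithmetic relative trace formula (with an appendix by Chao Li and Yihang Zhu)*,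
  Camb. J. Math. 9 (2021): App. B §B.3 p. 101 (the Siegel–hermitian Eisenstein series `E_{P_a}(·; f_{a,s})`), Lem. B.10 (2) p. 102.
* [Tan1999] V. Tan, *Poles of Siegel Eisenstein series on `U(n,n)`*, Canad. J. Math. 51 (1999) 164–175: §1.
* [GelbartRogawski1991] S. Gelbart, J. Rogawski, *L-functions and Fourier–Jacobi coefficients for the unitary group U(3)*, Invent.
  Math. 105 (1991): §3.1 (the doubled group of the datum; `χ|_{L^×} = 1` and the product formula on rational Siegel elements).
-/

noncomputable section

open scoped Matrix
open NumberField IsDedekindDomain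

namespace Summit.HodgeConjecture.HodgeConjecture.Cruxes.HLiu418.K2LiuSiegelEisensteinDoubledLeftInvariant

open Literature.NumberTheory.Automorphic Literature.NumberTheory.GaloisRepresentations
open Literature.NumberTheory.GelbartRogawski1991 Literature.NumberTheory.GelbartRogawski1991.GRConstruction
open Literature.NumberTheory.K2Lit.SiegelDoubled

section Aux

variable (L : Type) [Field L] [NumberField L] [IsCMField L]
variable {N M n : ℕ} (e : Fin N × Fin M ≃ Fin n)
  (dV : Fin N → L) (hdV : ∀ i, IsCMField.complexConj L (dV i) = dV i)
  (dW : Fin M → L) (hdW : ∀ i, IsCMField.complexConj L (dW i) = dW i)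

/-- **Representative independence of the summand** `γ ↦ f(γ h)` on `P_Δ(L⁺)`-cosets: for a Siegel section `f` and
`p ∈ P_Δ(L⁺)`, `f(p γ h) = f(γ h)` (the section transforms by the inducing character, which is `1` on rational elements:
★ `K2LiuSiegelCharacterTrivialOnRational.siegelDeltaCharacter_eq_one_of_mem_ratH`, file #10a).
[cite: Liu2021, §B.3 p. 101] [cite: Tan1999, §1] -/
theorem apply_siegelDeltaRat_mul {χ : HeckeCharacter L} {s : ℂ} {f : HA L e dV hdV dW hdW → ℂ}
    (hf : IsSiegelDeltaSection L e dV hdV dW hdW χ s f) (p : siegelDeltaRat L e dV hdV dW hdW)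
    (x : HA L e dV hdV dW hdW) :
    f ((((p : ratH L e dV hdV dW hdW) : HA L e dV hdV dW hdW)) * x) = f x := by
  have hpS : IsSiegelDelta L e dV hdV dW hdW ((p : ratH L e dV hdV dW hdW) : HA L e dV hdV dW hdW) :=
    (mem_siegelDelta_iff L e dV hdV dW hdW _).1 (Subgroup.mem_subgroupOf.1
      (show (p : ratH L e dV hdV dW hdW) ∈ (siegelDelta L e dV hdV dW hdW).subgroupOf (ratH L e dV hdV dW hdW)
        from p.2))
  rw [hf _ hpS x, K2LiuSiegelCharacterTrivialOnRational.siegelDeltaCharacter_eq_one_of_mem_ratH χ s (SetLike.coe_mem _), one_mul]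

/-- **Right multiplication by `γ ∈ H(L⁺)` permutes `P_Δ(L⁺)\H(L⁺)`**: there is a bijection `σ` of ★ `SiegelDeltaQuot` with
`σ⟦a⟧ = ⟦a γ⟧` (right multiplication commutes with the left `P_Δ(L⁺)`-action; Mathlib `Quotient.congr (Equiv.mulRight γ)`).
Packaged as an existence statement (this file declares no `def`). [cite: Liu2021, §B.3 p. 101] [cite: Tan1999, §1] -/
theorem exists_equiv_siegelDeltaQuot_mulRight (γ : ratH L e dV hdV dW hdW) :
    ∃ σ : SiegelDeltaQuot L e dV hdV dW hdW ≃ SiegelDeltaQuot L e dV hdV dW hdW,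
      ∀ a : ratH L e dV hdV dW hdW,
        σ (Quotient.mk _ a) = Quotient.mk (MulAction.orbitRel (siegelDeltaRat L e dV hdV dW hdW) (ratH L e dV hdV dW hdW)) (a * γ) := by
  refine ⟨Quotient.congr (Equiv.mulRight γ) fun a b => ?_, fun a => rfl⟩
  rw [MulAction.orbitRel_apply, MulAction.orbitRel_apply, MulAction.mem_orbit_iff, MulAction.mem_orbit_iff,
    Equiv.coe_mulRight]
  refine exists_congr fun p => ?_
  rw [Subgroup.smul_def, Subgroup.smul_def, smul_eq_mul, smul_eq_mul, ← mul_assoc]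
  exact (mul_left_inj γ).symm

end Aux

/-- **File #10b of the K2_Liu road (socket `sig_K2LiuSiegelEisensteinDoubledLeftInvariant`, statement VERBATIM): left
`H(L⁺)`-invariance of the Siegel–hermitian Eisenstein series of the doubled group `U(𝕍 ⊕ −𝕍)`.**  For a Siegel section `f` of
`I(s, χ)` (★ `IsSiegelDeltaSection`) and a rational `γ ∈ H(L⁺)`, `E(γ h; f) = E(h; f)` for every `h ∈ H(𝔸)` — pure algebra, no
convergence: right multiplication by `γ` permutes `P_Δ(L⁺)\H(L⁺)` (`exists_equiv_siegelDeltaQuot_mulRight`), `tsum` is invariant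
under re-indexing by an `Equiv` whatever the summability (Mathlib `Equiv.tsum_eq`), and the summand is representative-independent
(`apply_siegelDeltaRat_mul`, from the content of socket #10a).  Liu 2021 §B.3: `E_{P_a}(·; f_{a,s})` «on `U(V_a^◇)(𝔸_F)`» formed from
`U(V_a^◇)(F)`-cosets; Tan 1999 §1. [cite: Liu2021, §B.3 p. 101] [cite: Tan1999, §1] -/
theorem siegelEisensteinDoubledLeftInvariant :
    ∀ (L : Type) [Field L] [NumberField L] [IsCMField L] {N M n : ℕ} (e : Fin N × Fin M ≃ Fin n)
      (dV : Fin N → L) (hdV : ∀ i, IsCMField.complexConj L (dV i) = dV i)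
      (dW : Fin M → L) (hdW : ∀ i, IsCMField.complexConj L (dW i) = dW i)
      (χ : HeckeCharacter L) (s : ℂ) (f : HA L e dV hdV dW hdW → ℂ),
      IsSiegelDeltaSection L e dV hdV dW hdW χ s f →
        ∀ (γ : ratH L e dV hdV dW hdW) (h : HA L e dV hdV dW hdW),
          eisensteinSeriesDelta L e dV hdV dW hdW f ((γ : HA L e dV hdV dW hdW) * h) =
            eisensteinSeriesDelta L e dV hdV dW hdW f h := by
  intro L _ _ _ N M n e dV hdV dW hdW χ s f hf γ h
  obtain ⟨σ, hσ⟩ := exists_equiv_siegelDeltaQuot_mulRight L e dV hdV dW hdW γ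
  unfold eisensteinSeriesDelta
  -- re-index the series for `E(h; f)` along the permutation `σ` (no summability needed)
  rw [← Equiv.tsum_eq σ (fun q : SiegelDeltaQuot L e dV hdV dW hdW =>
    f (((Quotient.out q : ratH L e dV hdV dW hdW) : HA L e dV hdV dW hdW) * h))]
  refine tsum_congr fun q => ?_
  -- representatives: `(σ q).out = p * (q.out * γ)` with `p ∈ P_Δ(L⁺)`
  have hq : σ q = Quotient.mk (MulAction.orbitRel (siegelDeltaRat L e dV hdV dW hdW) (ratH L e dV hdV dW hdW))
      (Quotient.out q * γ) := by
    conv_lhs => rw [← Quotient.out_eq q]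
    exact hσ _
  have hrel : MulAction.orbitRel (siegelDeltaRat L e dV hdV dW hdW) (ratH L e dV hdV dW hdW)
      (Quotient.out (σ q)) (Quotient.out q * γ) :=
    Quotient.exact ((Quotient.out_eq (σ q)).trans hq)
  obtain ⟨p, hp⟩ := MulAction.mem_orbit_iff.1 (MulAction.orbitRel_apply.1 hrel)
  rw [Subgroup.smul_def, smul_eq_mul] at hp
  -- `hp : (p : H(L⁺)) * (q.out * γ) = (σ q).out`
  rw [← hp, Subgroup.coe_mul, Subgroup.coe_mul, mul_assoc, mul_assoc,
    apply_siegelDeltaRat_mul L e dV hdV dW hdW hf p]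

end Summit.HodgeConjecture.HodgeConjecture.Cruxes.HLiu418.K2LiuSiegelEisensteinDoubledLeftInvariant
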